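import Literature.AnabelianGeometry.SemiGraphs.ProfiniteSemiGraphIsoTransportApproximators
import Literature.AnabelianGeometry.SemiGraphs.CoveringGraphApproximators
import Literature.AnabelianGeometry.SemiGraphs.SgALocalizations
import HarnessLib

/-!
# [SemiAnbd] Def. 2.4 (i) along the profinite presentation: total elevation transfers from `𝒢` to
# `𝒢.toProfinite`, hence to the presentation of every tempered covering (bridge dictionary, t1 ⇒ t2)

Mochizuki, *Semi-graphs of anabelioids*, Publ. RIMS **42** (2006), Def. 2.3 (i)–(ii) pp. 24–25
("of bounded order … an approximator for `G` … `π₁`-epimorphic"), Def. 2.4 (i) p. 25 ("If, for every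
integer `M ≥ 1`, there exists a `π₁`-epimorphic approximator `G → G'` for `G` such that there exists
a subgroup `N_M ⊆ π̂₁(G'_v)` of order `≥ M` which has trivial intersection with all of the conjugates,
in `π̂₁(G'_v)`, of all of the `π̂₁(G'_e)` [where `e` ranges over the edges abutting to `v`], then we
shall say that `v` is elevated"), Rmk. 2.4.1 p. 26 (kurims `paper:url-f33ace170ff4`).
[cite: MochizukiSemiAnbd2006, Def. 2.4(i) p.25]

PROOF-ONLY (abc-iut-L3-t3 lineage, gen 13; GAP-LEDGER G-L3t3g11-1 (b): the t1 ↔ t2 dictionary for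
"totally elevated" along the (R1) bridge `SemiGraphOfAnabelioids.toProfinite`, B1/B2
`SgAToProfinite(Hom).lean`; no definition, approximators are `∃`-witnesses as in
`ProfiniteSemiGraphIsoTransportApproximators.lean`).  Def. 2.4 (i) is typed twice — t1
`SemiGraphOfAnabelioids.IsElevated` (`Commensurability.lean`, every basepoint and representative of
`Π'_b`) and t2 `ProfiniteSemiGraph.IsElevatedVertex` (`TemperedVerticial.lean`, finite `F_v`); §3 ⇒ §2
along `toAnab` is `PiPresentationBridgeElevated.lean`; this file is §2 ⇒ §3 along `toProfinite`:

1. `ProfiniteSemiGraph.exists_approximator_of_hom` — an approximator of `Y` PULLS BACK along ANY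
   morphism of presentations `F : X → Y` (`F'_v := F_{F v}`, `π'_v := π_{F v} ∘ hV_v`, branch maps those
   of `A` along `F b`), `π₁`-epimorphic when `A` is and the `hV_v`, `hE_e` are surjective; a subgroup
   of `F_{F v}` elevating `F v` elevates `v` (abc-iut-L3-d6's `exists_approximator_of_iso` with
   bijectivity kept only in the `π₁`-epimorphy clause — same construction);
2. `ProfiniteSemiGraph.exists_approximator_of_finite` — a presentation with FINITE vertex and edge
   groups of bounded order and injective `b_*` is its own `π₁`-epimorphic approximator;
3. ★ `SemiGraphOfAnabelioids.isElevated_toProfinite` / `isTotallyElevated_toProfinite` — for `𝒢` with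
   every edge abutting to a vertex, a §2 `π₁`-epimorphic approximator `φ : 𝒢 → 𝒢'` (t1
   `Hom.IsPi1EpiApproximator`) read on presentations (`φ.toProfinite`, B2) lands in `𝒢'.toProfinite`,
   whose `Π_v` are finite of bounded order at the canonical basepoints (Def. 2.3 (i)) and whose `Π_e`
   are finite by injectivity into an abutting `Π_v`; by 1.–2. it induces a `π₁`-epimorphic §3
   approximator of `𝒢.toProfinite` (`isPi1Epi_iff_surjective`), and t1's `N_M` at the basepoint
   `F_{𝒢', φ v}` works verbatim since `𝒢'.toProfinite.branchSubgroup` IS t1's `branchSubgroup` at the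
   canonical basepoints and chosen paths (B1 `branchSubgroup_toProfinite`, `rfl`);
4. `SgAQuot.SgA.isTotallyElevated_toProfinite`, and ★
   `SgAQuot.SgA.isTotallyElevated_toProfinite_of_isTemperedCoveringOf` — over a totally elevated `G`,
   the presentation of the source of every arrow `q : H → G` realised by a tempered object of
   `B^cov(G)` (`SgA.IsTemperedCoveringOf`, Def. 3.5 (ii), B4) is totally elevated: t2 heredity
   `CovObj.isTotallyElevated_coveringGraph` (abc-iut-L3-t2 lineage) and descent along the isomorphism
   over `G` (abc-iut-L3-d6 `isTotallyElevated_of_iso`).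

NOT done here (recorded, not claimed): the return leg t2 ⇒ t1 at `H` (t1's
`H.toSgA.IsTotallyElevated` needs §2 approximators of `H.toSgA` at its own universe) and the
quasi-coherent / universally sub-coverticial entries of the dictionary — the remaining inputs of the
Prop 4.3 (i) heredity law at `SemiAnbdVocab.real` (`AmbientVocabProp43i.lean`).  Nothing here takes a
side on [IUTchIII] Cor. 3.12; typed ≠ proved for the other §§4–5 statements.
-/

noncomputable section

namespace Literature.AnabelianGeometry.SemiGraphs

open CategoryTheory
open Literature.AnabelianGeometry.Anabelioids
open scoped Pointwise

universe u

/-- The conjugation action on subgroups is the image under `MulAut.conj`. [folklore] -/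
private theorem Subgroup.toConjAct_smul_eq_map_conj {G : Type*} [Group G] (g : G) (H : Subgroup G) :
    ConjAct.toConjAct g • H = H.map (MulAut.conj g).toMonoidHom := by
  ext x
  simp only [Subgroup.mem_map, Subgroup.mem_smul_pointwise_iff_exists, ConjAct.toConjAct_smul,
    MulEquiv.coe_toMonoidHom, MulAut.conj_apply]

namespace ProfiniteSemiGraph

variable {X Y : ProfiniteSemiGraph.{u}} (F : Hom X Y)

/-! ### 1. Pulling back an approximator along an arbitrary morphism of presentations -/

section Cast

variable {F} (A : Y.Approximator)

/-- Re-indexing along an equality of edges preserves injectivity. [cite: MochizukiSemiAnbd2006, Def 2.3 pp.24-25] -/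
private theorem cast_hom_injective {e₁ e₂ : Y.graph.Edge} (h : e₁ = e₂) {T : Type u} [Group T]
    (m : A.FE e₁ →* T) (hm : Function.Injective m) :
    Function.Injective (h ▸ m : A.FE e₂ →* T) := by
  subst h; exact hm

/-- Re-indexing along an equality of edges commutes with `π_e` up to `castGe`. [cite: MochizukiSemiAnbd2006, Def 2.3 pp.24-25] -/
private theorem cast_hom_apply_πE {e₁ e₂ : Y.graph.Edge} (h : e₁ = e₂) {T : Type u} [Group T]
    (m : A.FE e₁ →* T) (z : Y.Ge e₂) :
    (h ▸ m : A.FE e₂ →* T) (A.πE e₂ z) = m (A.πE e₁ (Y.castGe h.symm z)) := by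
  subst h; rfl

/-- Re-indexing along an equality of edges preserves the range. [cite: MochizukiSemiAnbd2006, Def 2.3 pp.24-25] -/
private theorem cast_hom_range {e₁ e₂ : Y.graph.Edge} (h : e₁ = e₂) {T : Type u} [Group T]
    (m : A.FE e₁ →* T) : (h ▸ m : A.FE e₂ →* T).range = m.range := by
  subst h; rfl

end Cast

/-- **Pull-back of approximators along an arbitrary morphism `F : X → Y` of profinite
presentations** (Def. 2.3 (ii): composing the morphism `Y → Y'` with `F`): for an approximator `A`
of `Y` there is an approximator `A'` of `X` with `F'_v = F_{F v}`, `π'_v = π_{F v} ∘ hV_v` (so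
`Ker π'_v = hV_v⁻¹(Ker π_{F v})`), `π₁`-epimorphic when `A` is and all `hV_v`, `hE_e` are surjective,
and whose branch images at `v` are LITERALLY the branch images of `A` at `F v` along the branches
`F b` — so a subgroup of `F_{F v}` elevating `F v` elevates `v`.
[cite: MochizukiSemiAnbd2006, Def 2.3(ii) p.25] -/
theorem exists_approximator_of_hom (A : Y.Approximator) :
    ∃ A' : X.Approximator,
      (A.IsPiOneEpimorphic → (∀ v, Function.Surjective (F.hV v)) →
        (∀ e, Function.Surjective (F.hE e)) → A'.IsPiOneEpimorphic) ∧
      (∀ (v : X.graph.Vertex) (k : X.Gv v),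
        A'.πV v k = 1 ↔ A.πV (F.base.vertexMap v) (F.hV v k) = 1) ∧
      (∀ (e : X.graph.Edge) (k : X.Ge e),
        A'.πE e k = 1 ↔ A.πE (F.base.edgeMap e) (F.hE e k) = 1) ∧
      ∀ (v : X.graph.Vertex) (N : Subgroup (A.FV (F.base.vertexMap v))),
        (∀ (b₁ : Y.graph.Branch) (h₁ : Y.graph.abuts b₁ = some (F.base.vertexMap v))
            (g : A.FV (F.base.vertexMap v)),
            N ⊓ ((A.brF b₁ _ h₁).range.map (MulAut.conj g).toMonoidHom) = ⊥) →
          ∃ N' : Subgroup (A'.FV v), Nat.card N' = Nat.card N ∧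
            ∀ (b : X.graph.Branch) (h : X.graph.abuts b = some v) (g' : A'.FV v),
              N' ⊓ ((A'.brF b v h).range.map (MulAut.conj g').toMonoidHom) = ⊥ := by
  classical
  choose c hc using fun b v h => F.exists_comm_castGe b v h
  choose gA hgA using A.comm
  -- the re-indexed branch maps
  let brF' : ∀ (b : X.graph.Branch) (v : X.graph.Vertex), X.graph.abuts b = some v →
      (A.FE (F.base.edgeMap (X.graph.edgeOf b)) →* A.FV (F.base.vertexMap v)) := fun b v h =>
    (F.base.edgeOf_branchMap b ▸
      A.brF (F.base.branchMap b) (F.base.vertexMap v) (F.base.abuts_branchMap b v h) :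
        A.FE (F.base.edgeMap (X.graph.edgeOf b)) →* A.FV (F.base.vertexMap v))
  have hinj : ∀ b v h, Function.Injective (brF' b v h) := fun b v h =>
    cast_hom_injective A (F.base.edgeOf_branchMap b) _ (A.brF_injective _ _ _)
  have happly : ∀ b v h (z : Y.Ge (F.base.edgeMap (X.graph.edgeOf b))),
      brF' b v h (A.πE _ z) = A.brF (F.base.branchMap b) (F.base.vertexMap v)
        (F.base.abuts_branchMap b v h) (A.πE _ (Y.castGe (F.base.edgeOf_branchMap b).symm z)) :=
    fun b v h z => cast_hom_apply_πE A (F.base.edgeOf_branchMap b) _ z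
  have hrange : ∀ b v h, (brF' b v h).range =
      (A.brF (F.base.branchMap b) _ (F.base.abuts_branchMap b v h)).range := fun b v h =>
    cast_hom_range A (F.base.edgeOf_branchMap b) _
  -- compatibility with the branch maps of `X`
  have hcomm : ∀ (b : X.graph.Branch) (v : X.graph.Vertex) (h : X.graph.abuts b = some v),
      ∃ g' : A.FV (F.base.vertexMap v), ∀ x : X.Ge (X.graph.edgeOf b),
        brF' b v h (((A.πE _).comp (F.hE (X.graph.edgeOf b)).toMonoidHom) x) =
          g' * ((A.πV _).comp (F.hV v).toMonoidHom) (X.brHom b v h x) * g'⁻¹ := by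
    intro b v h
    refine ⟨gA (F.base.branchMap b) (F.base.vertexMap v) (F.base.abuts_branchMap b v h) *
      (A.πV _ (c b v h))⁻¹, fun x => ?_⟩
    change brF' b v h (A.πE _ (F.hE _ x)) = _ * A.πV _ (F.hV v (X.brHom b v h x)) * _
    rw [happly b v h, hgA, hc b v h, map_mul, map_mul, map_inv]
    group
  obtain ⟨M, hM, hdvd⟩ := A.bounded
  let A' : X.Approximator :=
    { FV := fun v => A.FV (F.base.vertexMap v)
      FE := fun e => A.FE (F.base.edgeMap e)
      πV := fun v => (A.πV _).comp (F.hV v).toMonoidHom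
      πE := fun e => (A.πE _).comp (F.hE e).toMonoidHom
      isOpen_ker_πV := fun v => by
        rw [← MonoidHom.comap_ker, Subgroup.coe_comap]
        exact (A.isOpen_ker_πV _).preimage (F.hV v).continuous
      isOpen_ker_πE := fun e => by
        rw [← MonoidHom.comap_ker, Subgroup.coe_comap]
        exact (A.isOpen_ker_πE _).preimage (F.hE e).continuous
      brF := brF'
      brF_injective := hinj
      comm := hcomm
      bounded := ⟨M, hM, fun v => hdvd _⟩ }
  refine ⟨A', fun hA hV hE => ⟨fun v => (hA.1 _).comp (hV v), fun e => (hA.2 _).comp (hE e)⟩,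
    fun v k => Iff.rfl, fun e k => Iff.rfl, fun v N hN => ⟨N, rfl, fun b h g' => ?_⟩⟩
  change N ⊓ ((brF' b v h).range.map (MulAut.conj g').toMonoidHom) = ⊥
  rw [hrange b v h]
  exact hN _ _ g'

/-! ### 2. A presentation with finite groups of bounded order is its own approximator -/

/-- Totally disconnected spaces are `T₁` (points are connected components, which are closed). [folklore] -/
private theorem t1Space_of_totallyDisconnectedSpace (α : Type u) [TopologicalSpace α]
    [TotallyDisconnectedSpace α] : T1Space α :=
  ⟨fun x => connectedComponent_eq_singleton x ▸ isClosed_connectedComponent⟩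

/-- **A presentation `P` with FINITE vertex and edge groups, vertex groups of order dividing some
`M ≥ 1`, and injective `b_*` is its own `π₁`-epimorphic approximator** (Def. 2.3 (i)–(ii): `P` is
"of bounded order" and the identity `P → P` is an approximator): `F_v := Π_v`, `π_v := id`
(open kernel: finite `T₁` groups are discrete), branch maps the `b_*` themselves — so the branch
images are the `P.branchSubgroup` and a subgroup elevating `v` for `P.branchSubgroup` elevates `v`
for the approximator. [cite: MochizukiSemiAnbd2006, Def 2.3(ii) p.25] -/
theorem exists_approximator_of_finite (P : ProfiniteSemiGraph.{u}) [∀ w, Finite (P.Gv w)]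
    [∀ f, Finite (P.Ge f)] (hinj : P.IsOfInjectiveType)
    (hbd : ∃ M : ℕ, 0 < M ∧ ∀ w, Nat.card (P.Gv w) ∣ M) :
    ∃ A : P.Approximator, A.IsPiOneEpimorphic ∧
      (∀ (w : P.graph.Vertex) (k : P.Gv w), A.πV w k = 1 ↔ k = 1) ∧
      (∀ (f : P.graph.Edge) (k : P.Ge f), A.πE f k = 1 ↔ k = 1) ∧
      ∀ (w : P.graph.Vertex) (N : Subgroup (P.Gv w)),
        (∀ (b₁ : P.graph.Branch) (h₁ : P.graph.abuts b₁ = some w) (g : P.Gv w),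
            N ⊓ ((P.branchSubgroup b₁ w h₁).map (MulAut.conj g).toMonoidHom) = ⊥) →
          ∃ N' : Subgroup (A.FV w), Nat.card N' = Nat.card N ∧
            ∀ (b : P.graph.Branch) (h : P.graph.abuts b = some w) (g' : A.FV w),
              N' ⊓ ((A.brF b w h).range.map (MulAut.conj g').toMonoidHom) = ⊥ := by
  haveI : ∀ w, T1Space (P.Gv w) := fun w => t1Space_of_totallyDisconnectedSpace _
  haveI : ∀ f, T1Space (P.Ge f) := fun f => t1Space_of_totallyDisconnectedSpace _
  let A : P.Approximator :=
    { FV := P.Gv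
      FE := P.Ge
      πV := fun w => MonoidHom.id _
      πE := fun f => MonoidHom.id _
      isOpen_ker_πV := fun w => isOpen_discrete _
      isOpen_ker_πE := fun f => isOpen_discrete _
      brF := fun b w h => (P.brHom b w h).toMonoidHom
      brF_injective := fun b w h => hinj b w h
      comm := fun b w h => ⟨1, fun x => by simp⟩
      bounded := hbd }
  exact ⟨A, ⟨fun w => Function.surjective_id, fun f => Function.surjective_id⟩,
    fun w k => Iff.rfl, fun f k => Iff.rfl, fun w N hN => ⟨N, rfl, fun b h g' => hN b h g'⟩⟩

/-- **Elevation read through a `π₁`-epimorphic morphism into a finite presentation** (Def. 2.4 (i)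
at ONE level `M`): if `F : X → P` has surjective constituent homomorphisms, `P` has finite vertex
and edge groups of bounded order and injective `b_*`, and some subgroup `N ⊆ Π_{P, F v}` of order
`≥ M` meets every conjugate of every branch image `P.branchSubgroup b₁ (F v)` trivially, then
`X` admits a `π₁`-epimorphic approximator elevating `v` at level `M`.
[cite: MochizukiSemiAnbd2006, Def 2.4(i) p.25] -/
theorem exists_approximator_elevating_of_hom_finite {P : ProfiniteSemiGraph.{u}} (F : Hom X P)
    [∀ w, Finite (P.Gv w)] [∀ f, Finite (P.Ge f)] (hinj : P.IsOfInjectiveType)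
    (hbd : ∃ M : ℕ, 0 < M ∧ ∀ w, Nat.card (P.Gv w) ∣ M)
    (hV : ∀ v, Function.Surjective (F.hV v)) (hE : ∀ e, Function.Surjective (F.hE e))
    (v : X.graph.Vertex) (M : ℕ) (N : Subgroup (P.Gv (F.base.vertexMap v))) (hMN : M ≤ Nat.card N)
    (hN : ∀ (b₁ : P.graph.Branch) (h₁ : P.graph.abuts b₁ = some (F.base.vertexMap v))
      (g : P.Gv (F.base.vertexMap v)),
      N ⊓ ((P.branchSubgroup b₁ _ h₁).map (MulAut.conj g).toMonoidHom) = ⊥) :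
    ∃ A : X.Approximator, A.IsPiOneEpimorphic ∧ ∃ N' : Subgroup (A.FV v), M ≤ Nat.card N' ∧
      ∀ (b : X.graph.Branch) (h : X.graph.abuts b = some v) (g : A.FV v),
        N' ⊓ ((A.brF b v h).range.map (MulAut.conj g).toMonoidHom) = ⊥ := by
  obtain ⟨A, hAepi, -, -, hAel⟩ := P.exists_approximator_of_finite hinj hbd
  obtain ⟨N₁, hcard₁, hN₁⟩ := hAel (F.base.vertexMap v) N hN
  obtain ⟨A', hepi, -, -, hel⟩ := exists_approximator_of_hom F A
  obtain ⟨N', hcard', hN'⟩ := hel v N₁ hN₁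
  exact ⟨A', hepi hAepi hV hE, N', by rw [hcard', hcard₁]; exact hMN, hN'⟩

end ProfiniteSemiGraph

/-! ### 3. Def. 2.4 (i) transfers from `𝒢` to `𝒢.toProfinite` -/

namespace SemiGraphOfAnabelioids

variable {𝒢 𝒢' : SemiGraphOfAnabelioids.{u, u, u}}

/-- Every edge of the target of a morphism whose underlying morphism of semi-graphs is an
isomorphism abuts to a vertex as soon as every edge of the source does (the inverse exhibits every
edge as an image; images of abutting branches abut). [cite: MochizukiSemiAnbd2006, §1 p.11] -/
theorem everyEdgeAbuts_of_isIso_base (φ : Hom 𝒢 𝒢') [IsIso φ.base] (h : 𝒢.EveryEdgeAbuts) :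
    𝒢'.EveryEdgeAbuts := by
  intro f
  have hf : φ.base.edgeMap ((inv φ.base).edgeMap f) = f := by
    have h₁ := congrArg (fun k : 𝒢'.graph ⟶ 𝒢'.graph => k.edgeMap f) (IsIso.inv_hom_id φ.base)
    simp only [SemiGraph.comp_edgeMap, SemiGraph.id_edgeMap, Function.comp_apply, id_eq] at h₁
    exact h₁
  obtain ⟨b, v, hbe, hbv⟩ := h ((inv φ.base).edgeMap f)
  exact ⟨φ.base.branchMap b, φ.base.vertexMap v, by rw [φ.base.edgeOf_branchMap, hbe, hf],
    φ.base.abuts_branchMap b v hbv⟩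

/-- The vertex groups of the profinite presentation of a semi-graph of anabelioids OF BOUNDED ORDER
(Def. 2.3 (i)) are finite: `Π_v = Aut F_v` at the canonical basepoint.
[cite: MochizukiSemiAnbd2006, Def 2.3(i) p.24] -/
theorem finite_toProfinite_Gv (h : 𝒢'.IsOfBoundedOrder) (w : 𝒢'.graph.Vertex) :
    Finite (𝒢'.toProfinite.Gv w) := by
  obtain ⟨_, _, hb⟩ := h.exists_bound
  exact (hb w (𝒢'.fibV w)).1

/-- … of orders dividing a common `M ≥ 1` (Def. 2.3 (i)). [cite: MochizukiSemiAnbd2006, Def 2.3(i) p.24] -/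
theorem exists_bound_toProfinite_Gv (h : 𝒢'.IsOfBoundedOrder) :
    ∃ M : ℕ, 0 < M ∧ ∀ w, Nat.card (𝒢'.toProfinite.Gv w) ∣ M := by
  obtain ⟨M, hM, hb⟩ := h.exists_bound
  exact ⟨M, hM, fun w => (hb w (𝒢'.fibV w)).2⟩

/-- The edge groups of the profinite presentation of a semi-graph of anabelioids of bounded order in
which every edge abuts to a vertex are finite: `b_* : Π_e → Π_v` is injective (injective type, part
of Def. 2.3 (i)) into a finite `Π_v`. [cite: MochizukiSemiAnbd2006, Def 2.3(i) p.24] -/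
theorem finite_toProfinite_Ge (h : 𝒢'.IsOfBoundedOrder) (hab : 𝒢'.EveryEdgeAbuts)
    (f : 𝒢'.graph.Edge) : Finite (𝒢'.toProfinite.Ge f) := by
  obtain ⟨b, w, hbf, hbw⟩ := hab f
  subst hbf
  haveI := finite_toProfinite_Gv h w
  exact Finite.of_injective _
    ((𝒢'.isOfInjectiveType_toProfinite_iff.mpr h.isOfInjectiveType) b w hbw)

/-- A `π₁`-epimorphic 1-morphism induces SURJECTIVE vertex homomorphisms of profinite presentations
(`π₁(φ_v)` surjective at the canonical basepoint, [GeoAn] Def. 1.1.7 (ii) via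
`isPi1Epi_iff_surjective`, then transport along the chosen path).
[cite: MochizukiSemiAnbd2006, Def 2.3(ii) p.25] -/
theorem toProfinite_hV_surjective (φ : Hom 𝒢 𝒢') (v : 𝒢.graph.Vertex)
    (h : IsPi1Epi (φ.φV v).pullback) : Function.Surjective (φ.toProfinite.hV v) := by
  have hs := (isPi1Epi_iff_surjective (φ.over.φV v).pullback (𝒢.fibV v)).mp h
  change Function.Surjective (φ.over.hVOfPath v (φ.over.vertexPath v))
  intro y
  obtain ⟨x, hx⟩ := hs ((Aut.autMulEquivOfIso (φ.over.vertexPath v)).symm y)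
  refine ⟨x, ?_⟩
  rw [HomOver.hVOfPath_apply]
  exact (MulEquiv.eq_symm_apply _).mp hx

/-- Edge version: SURJECTIVE edge homomorphisms. [cite: MochizukiSemiAnbd2006, Def 2.3(ii) p.25] -/
theorem toProfinite_hE_surjective (φ : Hom 𝒢 𝒢') (e : 𝒢.graph.Edge)
    (h : IsPi1Epi (φ.φE e (φ.base.edgeMap e) rfl).pullback) :
    Function.Surjective (φ.toProfinite.hE e) := by
  have hs :=
    (isPi1Epi_iff_surjective (φ.over.φE e (φ.base.edgeMap e) rfl).pullback (𝒢.fibE e)).mp h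
  change Function.Surjective
    (φ.over.hEOfPath e (φ.base.edgeMap e) rfl (φ.over.edgePath e (φ.base.edgeMap e) rfl))
  intro y
  obtain ⟨x, hx⟩ :=
    hs ((Aut.autMulEquivOfIso (φ.over.edgePath e (φ.base.edgeMap e) rfl)).symm y)
  refine ⟨x, ?_⟩
  rw [HomOver.hEOfPath_apply]
  exact (MulEquiv.eq_symm_apply _).mp hx

/-- **Def. 2.4 (i) transfers along the profinite presentation, one vertex**: if `v` is elevated in
the semi-graph of anabelioids `𝒢` (every edge of which abuts to a vertex) in the sense of
`Commensurability.lean` (every basepoint, every representative of `Π'_b`), then `v` is an elevated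
vertex of the profinite presentation `𝒢.toProfinite` in the sense of `TemperedVerticial.lean`: the
§2 approximator `φ : 𝒢 → 𝒢'` read on presentations is a §3 approximator, and `N_M ⊆ π̂₁(𝒢'_{φ v})`
at the canonical basepoint meets the conjugates of the `𝒢'.toProfinite.branchSubgroup` — which ARE
t1's branch subgroups at the chosen paths (B1 `branchSubgroup_toProfinite`) — trivially.
[cite: MochizukiSemiAnbd2006, Def 2.4(i) p.25] -/
theorem isElevated_toProfinite (hab : 𝒢.EveryEdgeAbuts) (v : 𝒢.graph.Vertex)
    (hv : 𝒢.IsElevated v) : 𝒢.toProfinite.IsElevatedVertex v := by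
  intro M
  obtain ⟨𝒢', φ, hφ, hN⟩ := hv (max M 1) (le_max_right _ _)
  haveI : IsIso φ.base := hφ.isApproximator.isIso_base
  have hbo : 𝒢'.IsOfBoundedOrder := hφ.isApproximator.isOfBoundedOrder
  haveI : ∀ w, Finite (𝒢'.toProfinite.Gv w) := finite_toProfinite_Gv hbo
  haveI : ∀ f, Finite (𝒢'.toProfinite.Ge f) :=
    finite_toProfinite_Ge hbo (everyEdgeAbuts_of_isIso_base φ hab)
  -- t1's elevating subgroup at the canonical basepoint of `𝒢'_{φ v}`
  obtain ⟨N, -, hMN, hNdisj⟩ := hN (𝒢'.fibV (φ.base.vertexMap v))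
  have hN' : ∀ (b₁ : 𝒢'.graph.Branch) (h₁ : 𝒢'.graph.abuts b₁ = some (φ.base.vertexMap v))
      (g : Aut (𝒢'.fibV (φ.base.vertexMap v))),
      N ⊓ ((𝒢'.toProfinite.branchSubgroup b₁ _ h₁).map (MulAut.conj g).toMonoidHom) = ⊥ := by
    intro b₁ h₁ g
    have h' := hNdisj b₁ h₁ (𝒢'.fibE (𝒢'.graph.edgeOf b₁)) (𝒢'.branchPath b₁ _ h₁) g
    rw [Subgroup.toConjAct_smul_eq_map_conj] at h'
    exact h'
  obtain ⟨A, hAepi, N', hMN', hA⟩ :=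
    ProfiniteSemiGraph.exists_approximator_elevating_of_hom_finite φ.toProfinite
      ((𝒢'.isOfInjectiveType_toProfinite_iff).mpr hbo.isOfInjectiveType)
      (exists_bound_toProfinite_Gv hbo)
      (fun w => toProfinite_hV_surjective φ w (hφ.isPi1Epi_V w))
      (fun e => toProfinite_hE_surjective φ e (hφ.isPi1Epi_E e)) v (max M 1) N hMN hN'
  exact ⟨A, hAepi, N', (le_max_left M 1).trans hMN', hA⟩

/-- **Def. 2.4 (i) transfers along the profinite presentation**: a totally elevated semi-graph of
anabelioids every edge of which abuts to a vertex has a totally elevated profinite presentation.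
[cite: MochizukiSemiAnbd2006, Def 2.4(i) p.25] -/
theorem isTotallyElevated_toProfinite (hab : 𝒢.EveryEdgeAbuts) (h : 𝒢.IsTotallyElevated) :
    𝒢.toProfinite.IsTotallyElevated :=
  fun v => isElevated_toProfinite hab v (h.isElevated v)

end SemiGraphOfAnabelioids

/-! ### 4. At the ambient category of §§4–5, and along tempered arrows -/

namespace SgAQuot.SgA

open SemiGraphOfAnabelioids ProfiniteSemiGraph

/-- **A totally elevated object of the ambient category of §§4–5 has a totally elevated profinite
presentation** (every edge of an object of `SgA` abuts to a vertex, [IUTchI] Rmk 2.5.3 (iii)).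
[cite: MochizukiSemiAnbd2006, Def 2.4(i) p.25] -/
theorem isTotallyElevated_toProfinite (G : SgA.{u, u, u}) (h : G.toSgA.IsTotallyElevated) :
    G.toSgA.toProfinite.IsTotallyElevated :=
  SemiGraphOfAnabelioids.isTotallyElevated_toProfinite G.everyEdgeAbuts h

/-- **Over a totally elevated `G`, the covering semi-graph `G_S` of every TEMPERED object `S` of
`B^cov(G.toProfinite)` is totally elevated** — Rmk. 2.4.1 "`v' ↦ v` elevated ⇒ `v'` elevated" for
tempered coverings (t2 heredity `CovObj.isTotallyElevated_coveringGraph` of the abc-iut-L3-t2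
lineage, fed by `isTotallyElevated_toProfinite`). [cite: MochizukiSemiAnbd2006, Rmk 2.4.1 p.26] -/
theorem isTotallyElevated_coveringGraph_of_isTotallyElevated (G : SgA.{u, u, u})
    (h : G.toSgA.IsTotallyElevated) (S : CovObj G.toSgA.toProfinite) (hS : S.IsTempered) :
    S.coveringGraph.IsTotallyElevated :=
  S.isTotallyElevated_coveringGraph (isTotallyElevated_toProfinite G h) hS

variable {H G : SgA.{u, u, u}}

/-- ★ **Over a totally elevated `G`, the source of every arrow `q : H → G` realised by a tempered
object of `B^cov(G)` has a totally elevated profinite presentation** (Def. 3.5 (ii) via bridge B4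
`SgA.IsTemperedCoveringOf`: `H.toSgA.toProfinite ≅ G_S` over `G.toProfinite` for a tempered `S`;
`G_S` is totally elevated by the previous theorem and total elevation descends along the
isomorphism, abc-iut-L3-d6 `isTotallyElevated_of_iso`) — the t2 side of the "totally elevated"
clause of the heredity law of `Loc.basicPropertiesStatementI_real_of_heredity` (Prop 4.3 (i) at
`SemiAnbdVocab.real`); the return to t1's `H.toSgA.IsTotallyElevated` is NOT made here.
[cite: MochizukiSemiAnbd2006, Rmk 2.4.1 p.26] -/
theorem isTotallyElevated_toProfinite_of_isTemperedCoveringOf (q : H ⟶ G)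
    (hq : IsTemperedCoveringOf q) (h : G.toSgA.IsTotallyElevated) :
    H.toSgA.toProfinite.IsTotallyElevated := by
  obtain ⟨S, hS, ⟨I⟩⟩ := hq
  exact ProfiniteSemiGraph.isTotallyElevated_of_iso I.iso I.isLocallyTrivial
    (isTotallyElevated_coveringGraph_of_isTotallyElevated G h S hS)

end SgAQuot.SgA

end Literature.AnabelianGeometry.SemiGraphs

end
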